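import Literature.NumberTheory.EllipticCurves.PastenValuationProduct
import Summits.ABC.ABC.Theorems.SmallTamagawaConjecture
import HarnessLib

/-!
# `PastenValuationProduct` — consequences of the conjecture `SmallTamagawaConjecture`

Topic `NumberTheory/EllipticCurves`; namespace `Literature.NumberTheory.EllipticCurves`.
Conjecture/notion split (coordinator 2026-08-15): the vocabulary of H. Pasten, *Shimura curves and
the abc conjecture*, J. Number Theory 254 (2024) (= arXiv:1705.09251) stays in
`PastenValuationProduct.lean`; Pasten's OPEN Conjecture 1.14 ("fudge factors are small") is an
obligation of the ABC summit, canonical at `Summit.ABC.ABC.SmallTamagawaConjecture` (conjecture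
leaf `Summits/ABC/ABC/Theorems/SmallTamagawaConjecture.lean`); the Literature statements ABOUT the
conjecture live here, importing the leaf.

## Contents

* `pasten_thm_1_15_of_smallTamagawa` — the folklore remark that Conjecture 1.14
  (`Tam(E) < K_ε N_E^ε`) trivially implies both clauses of the unconditional Thm 1.15
  (`Tam(E) < K N_E^{11/2+ε}`), since `N_E ≥ 1` (moved here from
  `PastenValuationProductProofs.lean`, where it was keyed to the retired Literature duplicate of the
  conjecture).
-/

noncomputable section

namespace Literature.NumberTheory.EllipticCurves

open WeierstrassCurve

/-- **Conj 1.14 ⟹ Thm 1.15 (both clauses), trivially.** If `Tam(E) < K_ε · N_E^ε` for all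
`E/ℚ` (`Summit.ABC.ABC.SmallTamagawaConjecture`, Pasten's Conjecture 1.14, OPEN), then a fortiori
`Tam(E) < K · N_E^{11/2+ε}` with `K = max K_ε 1 > 0`, for every `E` (so in particular under the
hypotheses of `pasten_thm_1_15` and of `pasten_thm_1_15_semistable`), because `N_E ≥ 1`
(`conductorNorm_pos_holds`) makes `N_E^ε ≤ N_E^{11/2+ε}`. Pasten (p. 8) presents Thm 1.15 as
unconditional progress towards Conjecture 1.14; this is the converse bookkeeping.
[cite: PastenShimura2024, Conjecture 1.14, Theorem 1.15] -/
theorem pasten_thm_1_15_of_smallTamagawa (h : Summit.ABC.ABC.SmallTamagawaConjecture) :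
    pasten_thm_1_15 ∧ pasten_thm_1_15_semistable := by
  -- the common core: `Tam(E) < max K 1 · N_E^{11/2+ε}` for every elliptic `W`
  have core : ∀ ε : ℝ, 0 < ε → ∃ K : ℝ, 0 < K ∧ ∀ (W : WeierstrassCurve ℚ) [W.IsElliptic],
      (W.tamagawaProduct : ℝ) < K * (W.conductorNorm ℤ : ℝ) ^ (11 / 2 + ε : ℝ) := by
    intro ε hε
    obtain ⟨K, hK⟩ := h ε hε
    refine ⟨max K 1, lt_of_lt_of_le one_pos (le_max_right _ _), fun W _ => ?_⟩
    have hN : (1 : ℝ) ≤ (W.conductorNorm ℤ : ℝ) := by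
      exact_mod_cast conductorNorm_pos_holds W
    have hNε : 0 < (W.conductorNorm ℤ : ℝ) ^ (ε : ℝ) := Real.rpow_pos_of_pos (by linarith) _
    calc (W.tamagawaProduct : ℝ) < K * (W.conductorNorm ℤ : ℝ) ^ ε := hK W
      _ ≤ max K 1 * (W.conductorNorm ℤ : ℝ) ^ ε :=
          mul_le_mul_of_nonneg_right (le_max_left _ _) hNε.le
      _ ≤ max K 1 * (W.conductorNorm ℤ : ℝ) ^ (11 / 2 + ε : ℝ) := by
          exact mul_le_mul_of_nonneg_left (Real.rpow_le_rpow_of_exponent_le hN (by linarith))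
            (le_trans zero_le_one (le_max_right _ _))
  refine ⟨fun S ε hε => ?_, fun ε hε => ?_⟩
  · obtain ⟨K, hK, hKW⟩ := core ε hε
    exact ⟨K, hK, fun W _ _ _ => hKW W⟩
  · obtain ⟨K, hK, hKW⟩ := core ε hε
    exact ⟨K, hK, fun W _ _ => hKW W⟩

end Literature.NumberTheory.EllipticCurves

end
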